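import Summits.AnomalousDissipation.AnomalousDissipation.Theses.EulerLimit
import Summits.AnomalousDissipation.AnomalousDissipation.Theses.SteadyWeakLimit
import Literature.Analysis.FluidPDE.ClassicalNSFourierModes
import Literature.Analysis.FluidPDE.LinearizedNSTorus
import Literature.Analysis.FunctionSpaces.TorusCommutatorEstimate
import Literature.Analysis.FunctionSpaces.TorusMollifierAllOrders
import Literature.Analysis.FunctionSpaces.TorusMollifiedGradNorm
import Literature.Analysis.FunctionSpaces.TorusFluidGlueProofs

/-!
# Stub-ideation k1 — helper-lemma signatures for `stub_loudTightFamily` (elaboration sanity only)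

Scratch file of seat `sidea-stmt-AnomalousDissipation-0511-stub_loudTight-1`. Nothing here is
proved; every `sorry` is a PROPOSED HELPER LEMMA of the plan file
`STUB-IDEAS-stub_loudTightFamily-1.md`. `S1` below is a verbatim copy of the TYPE of the registered
stub `Cruxes/EulerlimitThesisV2/Lines/tight.lean :: stub_loudTightFamily` (never re-typed; copied
only so that the assembly helpers `…_of_…  : _ → S1` elaborate against it).
-/

noncomputable section

open MeasureTheory Set Filter Function
open scoped ENNReal NNReal InnerProductSpace RealInnerProductSpace Topology Convolution

namespace Summit.AnomalousDissipation.AnomalousDissipation.Cruxes.EulerlimitThesisV2.Tight.Ideas1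

open Literature.Analysis.FunctionSpaces Literature.Analysis.FunctionSpaces.Torus
open Literature.Analysis.FluidPDE

local notation "𝕋³" => UnitAddTorus (Fin 3)
local notation "E³" => EuclideanSpace ℝ (Fin 3)

/-- Verbatim copy of the type of `stub_loudTightFamily` (S1). -/
def S1 : Prop :=
  ∃ f : 𝕋³ → E³, Literature.Analysis.FunctionSpaces.Torus.IsSmooth f ∧
    Literature.Analysis.FunctionSpaces.Torus.IsDivFree f ∧
    Literature.Analysis.FunctionSpaces.Torus.HasZeroMean f ∧
    ∃ (τ c E M : ℝ), 0 < τ ∧ 0 < c ∧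
      ∃ (ν : ℕ → ℝ) (us : ℕ → ℝ → 𝕋³ → E³) (ps : ℕ → ℝ → 𝕋³ → ℝ),
        (∀ j, 0 < ν j) ∧ Filter.Tendsto ν Filter.atTop (nhds 0) ∧
        (∀ j, Literature.Analysis.FunctionSpaces.Torus.IsClassicalNSSolutionOn Set.univ (ν j)
            (fun _ => f) (us j) (ps j) ∧ Function.Periodic (us j) τ) ∧
        (∀ j t, ∫ x, ‖us j t x‖ ^ 2 ≤ E) ∧
        (∀ j, ∫⁻ t in Set.Ioo 0 τ, ∫⁻ x, ‖us j t x‖ₑ ^ 3 ≤ ENNReal.ofReal M) ∧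
        (∀ j, c ≤ ∫ t in (0 : ℝ)..τ,
            MeasureTheory.integral MeasureTheory.volume (fun x => inner ℝ (f x) (us j t x))) ∧
        (∀ ε : ℝ, 0 < ε → ∃ δ : ℝ, 0 < δ ∧ ∀ (j : ℕ) (s : ℝ) (h : 𝕋³), |s| ≤ δ → ‖h‖ ≤ δ →
            ∫⁻ t in Set.Ioo 0 τ, ∫⁻ x, ‖us j (t + s) (x + h) - us j t x‖ₑ ^ 3 ≤ ENNReal.ofReal ε)

/-! ## Plan A — time-tightness is slaved to space-tightness (residual `S1sp`) -/

/-- Uniform-in-`j`, period-integrated, purely SPATIAL `L³` modulus (the `s = 0` slice of S1's last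
clause). -/
def UniformSpatialL3Modulus (τ : ℝ) (us : ℕ → ℝ → 𝕋³ → E³) : Prop :=
  ∀ ε : ℝ, 0 < ε → ∃ δ : ℝ, 0 < δ ∧ ∀ (j : ℕ) (h : 𝕋³), ‖h‖ ≤ δ →
    ∫⁻ t in Set.Ioo 0 τ, ∫⁻ x, ‖us j t (x + h) - us j t x‖ₑ ^ 3 ≤ ENNReal.ofReal ε

/-- Residual `S1sp`: S1 with the `L³`-mass clause dropped and the space–time modulus replaced by
the spatial one. Trivially `S1 → S1sp`; Plan A proves `S1sp → S1`. -/
def S1sp : Prop :=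
  ∃ f : 𝕋³ → E³, IsSmooth f ∧ IsDivFree f ∧ HasZeroMean f ∧
    ∃ (τ c E : ℝ), 0 < τ ∧ 0 < c ∧
      ∃ (ν : ℕ → ℝ) (us : ℕ → ℝ → 𝕋³ → E³) (ps : ℕ → ℝ → 𝕋³ → ℝ),
        (∀ j, 0 < ν j) ∧ Tendsto ν atTop (𝓝 0) ∧
        (∀ j, IsClassicalNSSolutionOn Set.univ (ν j) (fun _ => f) (us j) (ps j) ∧
          Function.Periodic (us j) τ) ∧
        (∀ j t, ∫ x, ‖us j t x‖ ^ 2 ≤ E) ∧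
        (∀ j, c ≤ ∫ t in (0 : ℝ)..τ, ∫ x, ⟪f x, us j t x⟫_ℝ) ∧
        UniformSpatialL3Modulus τ us

/-- **A1 (pairing increment; mean-value theorem on the tested momentum equation
`Torus.IsClassicalNSSolutionOn.hasDerivWithinAt_integral_inner`).** -/
theorem abs_pairing_sub_le {ν : ℝ} {f : 𝕋³ → E³} {u : ℝ → 𝕋³ → E³} {p : ℝ → 𝕋³ → ℝ}
    (h : IsClassicalNSSolutionOn Set.univ ν (fun _ => f) u p)
    {a : 𝕋³ → E³} (ha : IsSmooth a) (hdiv : IsDivFree a) {K : ℝ}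
    (hK : ∀ t, |(∫ x, ⟪u t x, convect (u t) a x⟫_ℝ) + ν * (∫ x, ⟪u t x, laplacian a x⟫_ℝ) +
      ∫ x, ⟪f x, a x⟫_ℝ| ≤ K) (t s : ℝ) :
    |(∫ x, ⟪u (t + s) x, a x⟫_ℝ) - ∫ x, ⟪u t x, a x⟫_ℝ| ≤ K * |s| := by
  sorry

/-- **A1′ (rate constants of the doubly mollified test field `a = (w^ℓ)^ℓ`; sup bounds
`Torus.norm_iteratedFDeriv_lift_kernel_convolution_le_of_forall_le` (N = 1, 2) after
`Torus.norm_convolution_le`, and Cauchy–Schwarz).** `C` depends on `ℓ` only. -/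
theorem exists_rate_const {ℓ : ℝ} (hℓ : 0 < ℓ) (hℓ' : ℓ ≤ 1 / 4) :
    ∃ C : ℝ, 0 ≤ C ∧ ∀ (v w : 𝕋³ → E³), IsSmooth v → IsSmooth w →
      |∫ x, ⟪v x, convect v (vecMollify ℓ (vecMollify ℓ w)) x⟫_ℝ| ≤
          C * (∫ x, ‖w x‖) * ∫ x, ‖v x‖ ^ 2 ∧
      |∫ x, ⟪v x, laplacian (vecMollify ℓ (vecMollify ℓ w)) x⟫_ℝ| ≤
          C * (∫ x, ‖w x‖) * Real.sqrt (∫ x, ‖v x‖ ^ 2) ∧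
      ∀ g : 𝕋³ → E³, IsSmooth g →
        |∫ x, ⟪g x, vecMollify ℓ (vecMollify ℓ w) x⟫_ℝ| ≤
          Real.sqrt (∫ x, ‖g x‖ ^ 2) * Real.sqrt (∫ x, ‖w x‖ ^ 2) := by
  sorry

/-- **A2 (period-integrated `L²` time modulus from the spatial `L³` modulus).** With
`w = u(t+s) − u(t)`: `‖w‖₂² = ⟪w, w − (w^ℓ)^ℓ⟫ + ⟪w, (w^ℓ)^ℓ⟫`; first term by Cauchy–Schwarz,
Jensen (`Torus.eLpNorm_convolution_kernel_sub_self_le`), Hölder in `t` and periodicity,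
second term by A1 + A1′ (test field `a := (w^ℓ)^ℓ`, constants via `‖w‖₁ ≤ 2√E`). `C` depends on `ℓ` only. -/
theorem exists_const_period_normSq_sub_le {ℓ : ℝ} (hℓ : 0 < ℓ) (hℓ' : ℓ ≤ 1 / 4) :
    ∃ C : ℝ, ∀ (ν τ E ω : ℝ) (f : 𝕋³ → E³) (u : ℝ → 𝕋³ → E³) (p : ℝ → 𝕋³ → ℝ),
      IsClassicalNSSolutionOn Set.univ ν (fun _ => f) u p → Function.Periodic u τ → 0 < τ → 0 ≤ ν →
      IsSmooth f → (∀ t, ∫ x, ‖u t x‖ ^ 2 ≤ E) → 0 ≤ ω →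
      (∀ y : 𝕋³, ‖y‖ ≤ ℓ → ∫ t in (0 : ℝ)..τ, ∫ x, ‖u t (x + y) - u t x‖ ^ 3 ≤ ω) →
      ∀ s : ℝ, ∫ t in (0 : ℝ)..τ, ∫ x, ‖u (t + s) x - u t x‖ ^ 2 ≤
        16 * τ ^ (1 / 3 : ℝ) * ω ^ (2 / 3 : ℝ) +
          C * |s| * τ * (1 + ν) * (1 + ∫ x, ‖f x‖ ^ 2) * (1 + E) ^ 2 := by
  sorry

/-- **A3 (`L² → L³` upgrade with no `L^{p>3}` bound and no pressure):**
`w = (w − w^ℓ) + w^ℓ`, `∫₀^τ‖w − w^ℓ‖₃³ ≤ 32 ω` (Minkowski–Jensen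
`Torus.eLpNorm_integral_smul_le_mul` + periodicity), `‖w^ℓ‖₃³ ≤ ‖w^ℓ‖_∞ ‖w‖₂²`,
`‖w^ℓ‖_∞ ≤ C_ℓ ‖w‖₁ ≤ 2 C_ℓ √E`. Pure function-space lemma (no NS). -/
theorem exists_const_period_normCube_sub_le {ℓ : ℝ} (hℓ : 0 < ℓ) (hℓ' : ℓ ≤ 1 / 4) :
    ∃ C : ℝ, ∀ (τ E ω : ℝ) (u : ℝ → 𝕋³ → E³),
      IsSmoothSpaceTimeOn Set.univ u → Function.Periodic u τ → 0 < τ →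
      (∀ t, ∫ x, ‖u t x‖ ^ 2 ≤ E) →
      (∀ y : 𝕋³, ‖y‖ ≤ ℓ → ∫ t in (0 : ℝ)..τ, ∫ x, ‖u t (x + y) - u t x‖ ^ 3 ≤ ω) →
      ∀ s : ℝ, ∫ t in (0 : ℝ)..τ, ∫ x, ‖u (t + s) x - u t x‖ ^ 3 ≤
        32 * ω + C * Real.sqrt E * ∫ t in (0 : ℝ)..τ, ∫ x, ‖u (t + s) x - u t x‖ ^ 2 := by
  sorry

/-- **A0 (`L³` mass from energy + spatial modulus; same split as A3).** -/
theorem exists_const_period_normCube_le {ℓ : ℝ} (hℓ : 0 < ℓ) (hℓ' : ℓ ≤ 1 / 4) :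
    ∃ C : ℝ, ∀ (τ E ω : ℝ) (u : ℝ → 𝕋³ → E³),
      IsSmoothSpaceTimeOn Set.univ u → 0 < τ → (∀ t, ∫ x, ‖u t x‖ ^ 2 ≤ E) →
      (∀ y : 𝕋³, ‖y‖ ≤ ℓ → ∫ t in (0 : ℝ)..τ, ∫ x, ‖u t (x + y) - u t x‖ ^ 3 ≤ ω) →
      ∫ t in (0 : ℝ)..τ, ∫ x, ‖u t x‖ ^ 3 ≤ 4 * ω + C * τ * E * Real.sqrt E := by
  sorry

/-- **G (currency glue): for jointly smooth `g`, the stub's `lintegral` slab equals `ofReal` of the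
interval/Bochner integral.** -/
theorem lintegral_slab_eq_ofReal {τ : ℝ} (hτ : 0 < τ) {g : ℝ → 𝕋³ → E³}
    (hg : IsSmoothSpaceTimeOn Set.univ g) :
    ∫⁻ t in Set.Ioo 0 τ, ∫⁻ x, ‖g t x‖ₑ ^ 3 = ENNReal.ofReal (∫ t in (0 : ℝ)..τ, ∫ x, ‖g t x‖ ^ 3) := by
  sorry

/-- **Assembly A: `S1sp → S1`** (choose `ℓ₁` from the spatial modulus, then `ℓ₂`, then `δ`; all
constants depend on `ℓ, τ, E, sup ν_j, ‖f‖₂` only, so `δ` is uniform in `j`). -/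
theorem S1_of_S1sp : S1sp → S1 := by
  sorry

/-! ## Plan B — the steady sub-case (residual `S1st`; `IsSteadyNSState` is definitionally a
classical solution on constant data, `LinearizedNSTorus`) -/

/-- Residual `S1st`: loud, bounded, spatially `L³`-equicontinuous STEADY states at fixed force. -/
def S1st : Prop :=
  ∃ f : 𝕋³ → E³, IsSmooth f ∧ IsDivFree f ∧ HasZeroMean f ∧
    ∃ (c E : ℝ), 0 < c ∧
      ∃ (ν : ℕ → ℝ) (u : ℕ → 𝕋³ → E³) (p : ℕ → 𝕋³ → ℝ),
        (∀ j, 0 < ν j) ∧ Tendsto ν atTop (𝓝 0) ∧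
        (∀ j, Literature.Analysis.FluidPDE.Torus.IsSteadyNSState (ν j) f (u j) (p j)) ∧
        (∀ j, ∫ x, ‖u j x‖ ^ 2 ≤ E) ∧
        (∀ j, c ≤ ∫ x, ⟪f x, u j x⟫_ℝ) ∧
        (∀ ε : ℝ, 0 < ε → ∃ δ : ℝ, 0 < δ ∧ ∀ (j : ℕ) (h : 𝕋³), ‖h‖ ≤ δ →
            ∫⁻ x, ‖u j (x + h) - u j x‖ₑ ^ 3 ≤ ENNReal.ofReal ε)

/-- **B1: `S1st → S1`** (bookkeeping: `τ := 1`, `us j := fun _ => u j`, time shift vanishes,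
slab `lintegral` of a time-constant = the constant, `M` from A0 with `ω` := the modulus). -/
theorem S1_of_S1st : S1st → S1 := by
  sorry

/-- **B2 (by-product, links the stub to crux `SteadyWeakRealisation`, stmt-AnomalousDissipation-1303):
Kolmogorov–Riesz on `T³` + `∫⟪f,u_j⟫ ≥ c` pass to a strong `L³` subsequential limit.** -/
theorem steadyWeakRealisation_of_S1st :
    S1st → Summit.AnomalousDissipation.AnomalousDissipation.Theses.SteadyWeakLimit.SteadyWeakRealisation := by
  sorry

/-! ## Plan C — the one exact law of the same-force periodic family: the period-averaged energy
flux through scale `ℓ` is bounded by the input power (finite-`ℓ` 4/5–4/3-law budget); under a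
uniform anti-alignment hypothesis (Drivas 2022, Hyp. 2(b), family form) it yields the rate form of
`UniformSpatialL3Modulus`, and Plan A finishes. -/

/-- **C1 (period-averaged CET flux bound).** For a `τ`-periodic classical solution with constant
force: `|∫₀^τ ∫ ∑ᵢⱼ ((uᵢuⱼ) ⋆ k_ℓ) ∂ⱼ(u^ℓ)ᵢ| ≤ 2 τ ‖f‖₂ √E` for every `0 < ℓ ≤ 1/4`
(mollified energy balance over one period: flux = `ν∫₀^τ‖∇u^ℓ‖₂² − ∫₀^τ⟪f^ℓ,u^ℓ⟫`;
`Torus.eGradNormSq_vecMollify_le`, `Torus.IsClassicalNSSolutionOn.energy_balance_holds`). -/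
theorem abs_period_flux_vecMollify_le {ν τ E : ℝ} {f : 𝕋³ → E³} {u : ℝ → 𝕋³ → E³}
    {p : ℝ → 𝕋³ → ℝ} (h : IsClassicalNSSolutionOn Set.univ ν (fun _ => f) u p)
    (hper : Function.Periodic u τ) (hτ : 0 < τ) (hν : 0 < ν) (hf : IsSmooth f)
    (hE : ∀ t, ∫ x, ‖u t x‖ ^ 2 ≤ E) {ℓ : ℝ} (hℓ : 0 < ℓ) (hℓ' : ℓ ≤ 1 / 4) :
    |∫ t in (0 : ℝ)..τ, ∫ x, ∑ i, ∑ j, ((fun y => u t y i * u t y j) ⋆ kernel ℓ) x *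
        partialDeriv j (fun y => vecMollify ℓ (u t) y i) x| ≤
      2 * τ * Real.sqrt (∫ x, ‖f x‖ ^ 2) * Real.sqrt E := by
  sorry

/-- **Uniform anti-alignment hypothesis (Drivas 2022, arXiv:2111.03493, Hyp. 2(b) + Remark 3,
finite-`ℓ` family form):** the period-integrated ABSOLUTE third-order structure function at scale
`ℓ` is controlled by `ℓ^{1-β}` times the SIGNED flux through scale `ℓ`, uniformly in `j`. -/
def UniformAntiAlignment (τ : ℝ) (us : ℕ → ℝ → 𝕋³ → E³) : Prop :=
  ∃ (β CA ℓ₀ : ℝ), β < 1 ∧ 0 < ℓ₀ ∧ ℓ₀ ≤ 1 / 4 ∧ ∀ (j : ℕ) (ℓ : ℝ), 0 < ℓ → ℓ ≤ ℓ₀ →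
    ∀ y : 𝕋³, ‖y‖ ≤ ℓ →
      ∫ t in (0 : ℝ)..τ, ∫ x, ‖us j t (x + y) - us j t x‖ ^ 3 ≤
        CA * ℓ ^ (1 - β) * |∫ t in (0 : ℝ)..τ, ∫ x, ∑ i, ∑ k,
          ((fun z => us j t z i * us j t z k) ⋆ kernel ℓ) x *
            partialDeriv k (fun z => vecMollify ℓ (us j t) z i) x|

/-- **C2: flux bound + anti-alignment ⇒ uniform spatial modulus (rate `ℓ^{1-β}`).** -/
theorem uniformSpatialL3Modulus_of_antiAlignment {τ E : ℝ} {f : 𝕋³ → E³} {ν : ℕ → ℝ}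
    {us : ℕ → ℝ → 𝕋³ → E³} {ps : ℕ → ℝ → 𝕋³ → ℝ} (hτ : 0 < τ) (hf : IsSmooth f)
    (hν : ∀ j, 0 < ν j)
    (hsol : ∀ j, IsClassicalNSSolutionOn Set.univ (ν j) (fun _ => f) (us j) (ps j) ∧
      Function.Periodic (us j) τ)
    (hE : ∀ j t, ∫ x, ‖us j t x‖ ^ 2 ≤ E) (hA : UniformAntiAlignment τ us) :
    UniformSpatialL3Modulus τ us := by
  sorry

end Summit.AnomalousDissipation.AnomalousDissipation.Cruxes.EulerlimitThesisV2.Tight.Ideas1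

end
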